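/-
Origin: expansion seat `planner-pub-hodgecm-pv03-g6-0`, handover #3 2026-08-18T10:32:56Z (`HOME/pub-hodgecm-pv03-g6/lean/Pv03g6/G4WitnessCM.lean`, md5 377948c4, 177 lines);
landed by the gen-7 packager in gate run 28 as `HodgeCM/Model/ToyG2/G4WitnessCM.lean` (import ^import Pv03g6\.→import HodgeCM.Model.ToyG2. ×2).
-/
/-
Copyright (c) 2026. All rights reserved.
Released under Apache 2.0 license as described in the file LICENSE.
-/
import Mathlib
import Summits.HodgeConjecture.HodgeCM.Model.ToyG2.HodgeRieszCM_2
import Summits.HodgeConjecture.HodgeCM.Model.ToyG2.Restrict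
import Summits.HodgeConjecture.HodgeCM.Model.Toy.StarAlgDuality
import Summits.HodgeConjecture.HodgeCM.Model.ToyG2.TrTypeProd
import Summits.HodgeConjecture.HodgeCM.Model.ToyG2.ThetaModel3

/-!
# ToyG2.G4WitnessCM — the CM-good sub-universe of `toyUniverse₃ d t` and the G4 consistency witness

Seat `planner-pub-hodgecm-pv03-g6-0` (DAG-node prover #03, gen 6), nodes (U-CM) + (R-CM) of the G4 target
`∃ U : Universe, U.ModelAxioms ∧ U.RealisationExistsPerL ∧ U.RealisationExistsFace` (toy-g2 DESIGN.md §0, §9).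

* §1 `ConjData` is constructor-closed: products (`conjDataProd`), the empty object, finite product families
  (`conjDataProdFam`), CM atoms `cmObj K Φ` (`conjDataCmObj`, slotwise `cF K` of `Isogeny.lean`), the corner
  products `PP L Θ` (`Star.CP`, gen 1) and hence every period leaf `pLeafOf L ι₁ d t` (`conjDataPLeafOf`).
* §2 `IsCM X := Nonempty X.X.toObj.ConjData` on `GObj` is a `SubClosed` class of `toyUniverse₃ d t`, so
  `toyUniverseCM d t := (toyUniverse₃ d t).restrictObj IsCM _` is a universe (`Restrict.lean`).
* §3 M26 (`Fact_gysin_surface`) holds in `toyUniverseCM d t` GIVEN G1 (the surface trace kills the left radical,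
  `RadKilled`, for all good `S`, `X`, `f` — toy-g2's `radKilled_of_good`, `RadicalProdStep.lean`, handed over for the
  same gate run; taken here as the hypothesis `G1All` so that this file depends on installed modules only):
  `gysin_surfaceCM`, by GysinPlan's pointwise reduction with `hodgeRiesz_of_conjData` in place of `HodgeRiesz` for all
  good objects.  The other 27 axioms are toy-g2's `fact3_*` transported: `toyUniverseCM_modelAxioms`.
* §4 the realisation inputs are pv03-g5's `realisationExistsPerL₃/Face₃` transported; hence
  **`g4_witness_of_g1 : G1All → ∃ U, U.ModelAxioms ∧ U.RealisationExistsPerL ∧ U.RealisationExistsFace`** and, in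
  the model, the package's end state `PerL ∧ PeriodThmF ∧ W_RK4` (`endStateCM_of_g1`).  With toy-g2's
  `radKilled_of_good` the hypothesis is discharged (one line, `G4FinalCM.lean`).
-/

namespace HodgeCM.ToyG2

open HodgeCM.Toy HodgeCM.Toy.CMPresentation
open Literature.AlgebraicGeometry.Motives
open scoped TensorProduct
open exteriorPower Obj₂ HodgeCM.Universe

noncomputable section

/-! ### §1 Conjugation data for the constructors -/

/-- conjugation data of a binary product of generation-1 objects -/
def conjDataProd {A B : Obj} (CA : A.ConjData) (CB : B.ConjData) : (A.prod B).ConjData where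
  c | Sum.inl a => CA.c a
    | Sum.inr b => CB.c b
  emb_c | Sum.inl a => CA.emb_c a
        | Sum.inr b => CB.emb_c b

/-- conjugation data of the empty object -/
def conjDataEmpty : emptyObj.ConjData := ⟨fun e => e.elim, fun e => e.elim⟩

/-- conjugation data of a finite product family -/
def conjDataProdFam : (m : ℕ) → (B : Fin m → Obj) → (∀ k, (B k).ConjData) → (prodFam m B).ConjData
  | 0, _, _ => conjDataEmpty
  | m + 1, B, C => conjDataProd (C 0) (conjDataProdFam m (fun k => B k.succ) (fun k => C k.succ))

/-- conjugation data of the CM atom `A_{(K,Φ)}`: complex conjugation of the CM field `K`, transported to `F_K` -/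
def conjDataCmObj (K : CMField) (Φ : CMType K) : (cmObj K Φ).ConjData := ⟨fun _ => cF K, fun _ => emb_cF K⟩

/-- conjugation data of the period leaf `P(L, ι₁)` (a product of corner products `PP L Θ_q`, each with `Star.CP`) -/
def conjDataPLeafOf (L : CMField) (ι₁ : L →+* ℂ) (d t : ℚ) : (pLeafOf L ι₁ d t).O.ConjData :=
  conjDataProdFam (nQ L ι₁) (blockFam L ι₁) fun k => Star.CP L (ΘOf L ι₁ k)

/-! ### §2 The CM-good sub-universe -/

/-- a good object "is CM" if its generation-1 object carries conjugation data -/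
def IsCM (X : GObj) : Prop := Nonempty X.X.toObj.ConjData

/-- (Ported verbatim from the HodgeCMPerL package; no docstring in the source.) -/
theorem isCM_prod {X Y : GObj} (hX : IsCM X) (hY : IsCM Y) : IsCM (X.prod Y) := by
  obtain ⟨CX⟩ := hX
  obtain ⟨CY⟩ := hY
  exact ⟨conjDataProd CX CY⟩

/-- (Ported verbatim from the HodgeCMPerL package; no docstring in the source.) -/
theorem isCM_cm (K : CMField) (Φ : CMType K) : IsCM (GObj.cm K Φ) := ⟨conjDataCmObj K Φ⟩

/-- (Ported verbatim from the HodgeCMPerL package; no docstring in the source.) -/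
theorem isCM_pb (p : PLeaf) (h : (Leaf.pb p).Good) (C : p.O.ConjData) : IsCM (GObj.pb p h) := ⟨C⟩

/-- `IsCM` is closed under the constructors of `toyUniverse₃ d t` -/
theorem isCM_subClosed (d t : ℚ) : (toyUniverse₃ d t).SubClosed IsCM where
  prod _ _ hX hY := isCM_prod hX hY
  cmAV K Φ := isCM_cm K Φ
  pms L ι₁ _ _ := isCM_pb _ ((gplOf d t).good L ι₁) (conjDataPLeafOf L ι₁ d t)

/-- **the CM-good toy universe**: the full sub-universe of `toyUniverse₃ d t` on the good objects with conjugation data -/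
abbrev toyUniverseCM (d t : ℚ) : Universe := (toyUniverse₃ d t).restrictObj IsCM (isCM_subClosed d t)

/-! ### §3 The model axioms of `toyUniverseCM d t`, given G1 -/

/-- G1 for all good surfaces and targets: the pulled-back surface trace kills the left radical
(= toy-g2's `radKilled_of_good`, `RadicalProdStep.lean`) -/
def G1All : Prop := ∀ (S X : Obj₂) (f : Hom₂ S X), S.Good → X.Good → S.dim = 2 → RadKilled S X f

/-- **M26 in the CM-good universe**, given G1: GysinPlan's reduction, pointwise, with Hodge–Riesz supplied by
`hodgeRiesz_of_conjData` -/
theorem gysin_surfaceCM (d t : ℚ) (h1 : G1All) : (toyUniverseCM d t).Fact_gysin_surface := by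
  intro S X f hS
  obtain ⟨C⟩ := X.2
  change S.1.X.dim = 2 at hS
  obtain ⟨c, hc, hyc⟩ := hodgeRiesz_of_conjData X.1.X X.1.good C (trOf S.1.X 4 ∘ₗ map 4 f.lin)
    (pull_type22_of_trType f hS (trType_of_good S.1.good))
    (fun y hy => h1 S.1.X X.1.X f S.1.good X.1.good hS y hy)
  exact ⟨c, hc, fun y => hyc y⟩

/-- **all 28 model axioms hold in `toyUniverseCM d t`**, given G1 (27 transported from toy-g2's `fact3_*`) -/
theorem toyUniverseCM_modelAxioms (d t : ℚ) (h1 : G1All) : (toyUniverseCM d t).ModelAxioms where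
  pull_id := restrictObj_pull_id _ (fact3_pull_id _ _ _)
  pull_comp := restrictObj_pull_comp _ (fact3_pull_comp _ _ _)
  pull_cup := restrictObj_pull_cup _ (fact3_pull_cup _ _ _)
  pull_hodge := restrictObj_pull_hodge _ (fact3_pull_hodge _ _ _)
  cup2_hodge := restrictObj_cup2_hodge _ (fact3_cup2_hodge _ _ _)
  tr_degree := restrictObj_tr_degree _ (fact3_tr_degree _ _ _)
  alg_le_hodge := restrictObj_alg_le_hodge _ (fact3_alg_le_hodge _ _ _)
  pull_alg := restrictObj_pull_alg _ (fact3_pull_alg _ _ _)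
  cup_alg := restrictObj_cup_alg _ (fact3_cup_alg _ _ _)
  lefschetz11 := restrictObj_Lefschetz11 _ (fact3_lefschetz11 _ _ _)
  cmAV := restrictObj_cmAV _ (fact3_cmAV _ _ _)
  eigenLine := restrictObj_eigenLine_fact _ (fact3_eigenLine _ _ _)
  alphaLine := restrictObj_alphaLine_fact _ (fact3_alphaLine _ _ _)
  cmDominated := restrictObj_cmDominated _ (fact3_cmDominated _ _ _ galoisCMOracle)
  weilLine_rank := restrictObj_weilLine_rank _ (fact3_weilLine_rank _ _ _)
  weilLine_hodge := restrictObj_weilLine_hodge _ (fact3_weilLine_hodge _ _ _)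
  pms_dim := restrictObj_pmsDimTwo _ (fact3_pms_dim _ _ _)
  lift := restrictObj_lift _ (fact3_lift _ _ _)
  cup_comm1 := restrictObj_cup_comm1 _ (fact3_cup_comm1 _ _ _)
  cup_interchange := restrictObj_cup_interchange _ (fact3_cup_interchange _ _ _)
  kunneth1 := restrictObj_kunneth1 _ (fact3_kunneth1 _ _ _)
  H1_rank := restrictObj_H1_rank _ (fact3_H1_rank _ _ _)
  H4_span := restrictObj_H4_span _ (fact3_H4_span _ _ _)
  cmEnd := restrictObj_cmEnd _ (fact3_cmEnd _ _ _)
  conjIsogeny := restrictObj_conjIsogeny _ (fact3_conjIsogeny _ _ _)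
  gysin_surface := gysin_surfaceCM d t h1
  deg_diag := restrictObj_deg_diag _ (fact3_deg_diag _ _ _)
  algDuality := restrictObj_algDuality _ (fact3_algDuality _ _)

/-! ### §4 The realisation inputs and the G4 witness -/

section Inputs

open HodgeCM.ToyG2.ThetaUiso

variable (d t : ℚ) (hd : (1 : ℚ) ≤ d) (ht : t ^ 2 = 16)
include hd ht

/-- (Ported verbatim from the HodgeCMPerL package; no docstring in the source.) -/
theorem realisationExistsPerLCM : (toyUniverseCM d t).RealisationExistsPerL :=
  restrictObj_realisationExistsPerL _ (realisationExistsPerL₃ d t hd ht)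

/-- (Ported verbatim from the HodgeCMPerL package; no docstring in the source.) -/
theorem realisationExistsFaceCM : (toyUniverseCM d t).RealisationExistsFace :=
  restrictObj_realisationExistsFace _ (realisationExistsFace₃ d t hd ht)

/-- `ModelAxioms ∧ RealisationExistsPerL ∧ RealisationExistsFace` for `toyUniverseCM d t`, given G1 -/
theorem g4CM_of_g1 (h1 : G1All) :
    (toyUniverseCM d t).ModelAxioms ∧ (toyUniverseCM d t).RealisationExistsPerL
      ∧ (toyUniverseCM d t).RealisationExistsFace :=
  ⟨toyUniverseCM_modelAxioms d t h1, realisationExistsPerLCM d t hd ht, realisationExistsFaceCM d t hd ht⟩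

/-- in `toyUniverseCM d t`, given G1: the package's end state `PerL ∧ PeriodThmF ∧ W_RK4`
(`HodgeCM.Assembly.perL / periodThmF / w_rk4` at the model's axioms and realisations) -/
theorem endStateCM_of_g1 (h1 : G1All) :
    (toyUniverseCM d t).PerL ∧ (toyUniverseCM d t).PeriodThmF ∧ (toyUniverseCM d t).W_RK4 :=
  have M := toyUniverseCM_modelAxioms d t h1
  ⟨Assembly.perL _ M (realisationExistsPerLCM d t hd ht), Assembly.periodThmF _ M (realisationExistsFaceCM d t hd ht),
    Assembly.w_rk4 _ M (realisationExistsFaceCM d t hd ht)⟩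

end Inputs

/-- **the G4 consistency witness, given G1**: at `d = 1`, `t = 4`,
`∃ U, U.ModelAxioms ∧ U.RealisationExistsPerL ∧ U.RealisationExistsFace` -/
theorem g4_witness_of_g1 (h1 : G1All) :
    ∃ U : Universe, U.ModelAxioms ∧ U.RealisationExistsPerL ∧ U.RealisationExistsFace :=
  ⟨toyUniverseCM 1 4, g4CM_of_g1 1 4 le_rfl (by norm_num) h1⟩

end

end HodgeCM.ToyG2
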